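import Mathlib
import HarnessLib
import HarnessLib.Audit
import Summits.AnomalousDissipation.Statement
import Literature.Analysis.FluidPDE.NSGalerkinFourier
import Literature.Analysis.FluidPDE.LerayHopf
import Literature.Analysis.FluidPDE.StatisticalSolution
import HarnessLib.Audit.Status.Attr

/-!
Route: MirrorVariety

# Route MirrorVariety — AnomalousDissipation (Literature.Turb.ZerothLaw). Spine card
dodger-parity-negative-viscosity-mirror; crux cards stagnation-plug-froth (picked line of crux #2),
reynolds-series-sheet-jump, index-census-persistence.

## Thesis X (words) — loud bounded points on the mirror-doubled steady Galerkin varieties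
It suffices to exhibit ONE smooth divergence-free mean-zero steady force f on T³, viscosities ν_j →
0⁺ and constants E, ε > 0 such that for every j and INFINITELY MANY resolutions N there is a
Fourier–Galerkin steady state U at (N, ν_j) — smooth, div-free, mean-zero, band-limited to 0 < |k| ≤
N, solving the tested Galerkin equations ∫⟨U,(U·∇)a⟩ + ν_j⟨U,Δa⟩ + ⟨f,a⟩ = 0 for every band-limited
smooth div-free a (verbatim the form of Literature exists_steady_galerkin_approx) — with ∫|U|² ≤ E
and ν_j‖∇U‖² ≥ ε (decl GalerkinSteadyZerothLaw). Deciding instance = crux #2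
TaylorGreenLoudGalerkinStates: f = f_TG = (sin2πx₁cos2πx₂cos2πx₃, −cos2πx₁sin2πx₂cos2πx₃, 0) and ALL
large N (∀ᶠ ⇒ ∃ᶠ: support TaylorGreenFeedsTarget, ten lines over the landed
isSmooth/isDivFree/hasZeroMean_tgForce).
Lean: ∃ f, IsSmooth f ∧ IsDivFree f ∧ HasZeroMean f ∧ ∃ (ν : ℕ → ℝ) (E ε : ℝ), (∀ j, 0 < ν j) ∧
Tendsto ν atTop (nhds 0) ∧ 0 < ε ∧ ∀ j, ∃ᶠ N in atTop, ∃ U, (IsSmooth U ∧ IsDivFree U ∧ HasZeroMean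
U ∧ (∀ k ∉ (freqBall N).erase 0, mFourierCoeff (complexify ∘ U) k = 0) ∧ ∀ a, IsSmooth a → IsDivFree
a → (∀ k ∉ (freqBall N).erase 0, mFourierCoeff (complexify ∘ a) k = 0) → ∫ x, (⟪U x, convect U a x⟫
+ ν j * ⟪U x, laplacian a x⟫ + ⟪f x, a x⟫) = 0) ∧ ∫ x, ‖U x‖^2 ≤ E ∧ ε ≤ ν j * gradNormSq U

## Assembly X → AnomalousDissipation (deciding theorem `closes`, authority native)
closes (hX : GalerkinSteadyZerothLaw) (hT : FixedViscosityTransfer) (hS :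
SteadyWeakIsGlobalLerayHopf) : AnomalousDissipation — twelve lines of logic, certified.
FixedViscosityTransfer (support; Temam1979 Ch. II Thm 1.2 (ii) run on the GIVEN zeros; in-tree twin
exists_steady_galerkin_limit + discharged Temam1979_steadyWeakSolution_energy_eq_holds): at fixed ν
the loud bounded zeros at infinitely many N are H¹-bounded (ν‖∇U_N‖² = (f,U_N) ≤ ‖f‖√E), a
subsequence converges strongly in L² to a steady weak solution u ∈ V with ∫|u|² ≤ E and, by the
energy EQUATION, ν‖∇u‖² = (f,u) = lim ν‖∇U_N‖² ≥ ε. SteadyWeakIsGlobalLerayHopf (support, folklore):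
the constant path is a global Leray–Hopf solution whose long-time means are ∫|u|² and ν‖∇u‖². No
pressure, regularity or statistics enter; both supports rest on PROVED tree material (route
staffable: 0 unproved deps in a cone of 67 constants).

## The lever — three parts acting on ONE object: the steady Galerkin variety V_N(g) = {(c,ν) : νAc +
B_N(c,c) = g} over ALL real ν, inside the mirror class Fix K of f_TG (K = the three coordinate
reflections x_i ↦ −x_i; f_TG ∈ Fix K)
(L1) MIRROR + TAMENESS (structure and address). σ(c,ν) = (−c,−ν) preserves V_N(g) (B is even) and
acts freely (F(0,0) = g ≠ 0); for regular g, V_N is finitely many lines and circles (BPR Thm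
5.21–5.22) and no line is σ-invariant, so the Stokes arc and its mirror are different components and
every non-compact component ends in an energy runaway at ν → 0^± along an unforced truncated-Euler
profile (exact properness identity |ν|·4π²Σ|k|²|c_k|² = Re⟨g,c⟩). Loud BOUNDED points are an N → ∞
phenomenon on the diagonal N ≥ (ε/4π²νE)^{1/2} (landed resolution_floor); if LaminarNeverLoud holds
they sit on isolas/arches that ν-continuation from Stokes cannot reach; the total Brouwer index of
V_N ∩ {ν} is +1 at every (N, ν > 0) (census detector). Cruxes LaminarNeverLoud, MirrorDisconnection,
GenericRunawayStokesScaling make this decidable level by level.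
(L2) NEWTON DATA IN THE MIRROR CLASS (existence engine of crux #2). A K-symmetric Newton datum (v,
η, M) at viscosity ν — approximate state, residual η in the dual energy norm on Fix K, inf-sup
constant M of the linearisation on Fix K — with M²η ≤ c (c universal, ν-independent) yields
K-Galerkin steady states within 2Mη of v for ALL large N (discrete Brezzi–Rappaz–Raviart =
GiraultRaviart1979 Ch. IV Lemma 3.3 + Thm 3.3; registered stub stub_galerkinNewton;
finite-dimensional Kantorovich = tree SimplifiedNewton.lean); Palais criticality (stub_criticality)
upgrades K-tested equations to the crux's. Crux #2 = a Newton-ready K-family along ν_j → 0 with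
M_j²η_j → 0 (stub_froth, the heart): the input format of the a-posteriori validation technology that
closed the nearest comparable statements (BergBredenLessardVeen2021 Thm 1.1, a non-laminar periodic
orbit of Taylor–Green-column-forced NS on T³ in a 16-element symmetry class; Watanabe2009, steady
Kolmogorov flows).
(L3) EXACT REYNOLDS SERIES OF THE SINGLE-SHELL FORCE (finder; finite N speaks verbatim about N = ∞).
f_TG is ONE Stokes shell (|k|² = 3, Δf = −12π²f, ∫|f|² = 1/4) one Reynolds step from Euler-steady
(P₃B(f,f) = 0), so the order-p Reynolds coefficient of the laminar K-state is a trigonometric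
polynomial of degree ≤ p, identical for the PDE and every Galerkin level N ≥ √3·p. Computed exactly
to order 34 (kit j009556): radius ν_c = 0.0144, nearest singularities a complex-conjugate PAIR (arg
±174.5°), not a fold — the laminar sheet is real-analytic through ν_c and the adjacent Riemann sheet
is REAL over real ν: an address and a finder (algebraic approximants, deflated Newton) for
non-laminar K-states. The eigenforce identity 12π²ν(f,U) = 1/4 + ∫⟨U,(U·∇)f⟩, (f,U) = ν‖∇U‖² (item
EigenforceWorkIdentity) pins the flux out of the forcing shell of EVERY bounded state to 1/4 + O(ν)
and reads loud/quiet off one cubic functional.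
WHY THIS FORM IS EASIER than the summit-strength X: rationale, WHY THIS LINE (E1)–(E4) + the honest
residual.

Rationale: WHY THIS LINE. X (and crux #2) imply CoherentStates.SteadyZerothLaw for f through
FixedViscosityTransfer, so the reduction is summit-strength; what the finite-N / mirror-class form
buys is stated precisely. (E1) INPUT FORMAT OF A PROOF TECHNOLOGY: at each ν_j the unknowns are
zeros of d_N real quadrics, and existence at ALL large N follows from FINITE Newton data (v, η, M)
with M²η ≤ c by a theorem with ν-independent constants (GiraultRaviart1979 Ch. IV Def. 2.1, Lemma
3.3, Thm 3.3 = BrezziRappazRaviart1980 Part I; stub_galerkinNewton) — no pressure, no steady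
regularity, no Fredholm theory (finite-dimensional inf-sup ⇒ invertible), and a nonzero Brouwer
index suffices in place of nondegeneracy (KrasnoselskiiZabreiko1984, projection theorem; held).
A-posteriori Newton–Kantorovich validation in symmetry-reduced Fourier space CLOSED the nearest
comparable statements — BergBredenLessardVeen2021 Thm 1.1 (periodic orbit of TG-column-forced NS on
T³, ν = 0.265, C⁰-radius 2.2e-6), Watanabe2009 (steady Kolmogorov flows) — so every finite-j
instance of #2 is certifiable (kit milestone, interval Newton + BRR), and the OPEN content is
isolated in one analytic object: a Newton-ready family with M_j²η_j → 0 (stub_froth). (E2) SYMMETRY: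
Fix K is invariant under the Galerkin map and Newton's method (Palais1979; stub_criticality), pins
the lattice {0,½}³ as stagnation points with impermeable planes, discards the K-odd
(symmetry-breaking pitchfork) directions that destroy inf-sup constants on the full space, and cuts
the mode count 8-fold — the reduction that made BergBredenLessardVeen2021 feasible. (E3) EXACTNESS:
for the single-shell non-Euler-steady f_TG the Reynolds coefficients are finite trigonometric
polynomials (order = wavenumber), so the laminar PDE sheet, its radius ν_c = 0.0144 and its complex
branch pair are computed WITHOUT discretisation error (kit j009556) — the only place on this summit
where finite N speaks verbatim about N = ∞, and a finder for non-laminar states by sheet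
continuation (VanDyke/Drazin–Tourigny-type algebraic approximants) where pseudo-arclength in ν
provably fails. (E4) Every statement has a finite-dimensional falsifier (continuation / deflation /
monodromy census at N ≤ 24) and the structural cruxes are finite-N theorems-or-counterexamples with
tree material (MirrorDisconnection: RegularLevelCurves*, BPR = book:basu2006 Thm 5.21–5.22; grounder
g21-1: provable now). HONEST RESIDUAL: the ν_j → 0 uniformity is not made easier by finite N —
landed Negative/LoadBearing `not_crux_iff`: a refutation of #2 is a uniform-in-N laminarisation
theorem for bounded steady TG Galerkin states (= SteadyNeg 0222 at Galerkin level), open in 3-D; the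
route localises the summit's difficulty in stub_froth and supplies the certifier (E1) and the finder
(E3) for its instances. Imported areas: numerical bifurcation / a-posteriori validation
(GiraultRaviart1979, BrezziRappazRaviart1980, BergBredenLessardVeen2021, SchreiberKeller1983),
real-algebraic geometry (book:basu2006, MilnorTDV1965), stretched-vortex asymptotics
(MoffattKidaOhkitani1994, GallayWayne2006, GallayMaekawa2010, KerrDold1994), large-order series
(LiSinai2008, BrachetEtAl1983).
RANKED CRUXES. #2 TaylorGreenLoudGalerkinStates (deciding; ATTACK = picked line
stagnation-plug-froth, chosen by two successive leads over depth-dichotomy-lanford): composition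
TaylorGreenLoudGalerkinStates_of kernel-checked in
Theorems/MirrorVarietyTaylorGreenLoudGalerkinStatesLine.lean (p73960) from four registered stubs —
stub_tgForceRegular PROVED (p75219; Negative/Anatomy p73331: f_TG = realTrigPoly on the 8-point
shell, f̂(k) = (i/8)(−k₀,k₁,0)), stub_criticality (Palais, M-sized, true), stub_galerkinNewton (GR
Thm 3.3 in Fix K, XL, a theorem), stub_froth (HEART: K-symmetric Newton data — thin strained vortex
rings/tubes held at the K-lattice hyperbolic stagnation points, nested aperture-in-aperture to depth
≍ log(1/ν_j), energies geometric, total variation divergent; local engines in print: Burgers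
vortices exist and are stable for all circulation Reynolds numbers (GallayWayne2006,
GallayMaekawa2010), steady strained periodic vortex arrays (KerrDold1994, Kerr2024), inner/outer
gluing (DavilaEtAl2022)). Standing disprover: NO KILL after two cycles (Disproof.lean, 0 sorry).
First lemma Monday morning: EigenforceWorkIdentity (item, S); first milestone: the one-generation
Newton datum at log energy (the former rung #3, now a `--supports` target of #2). #0
GalerkinSteadyZerothLaw (2986, target X, auto-crux), fed by #2 through TaylorGreenFeedsTarget
(14162). Supports: MirrorDisconnection (2989, rank 4, provable now), EigenforceWorkIdentity (14587;
first half landed: Negative/Eigenforce.lean `eigenforce_identity`), TaylorGreenFeedsTarget,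
FixedViscosityTransfer (2991), SteadyWeakIsGlobalLerayHopf (2992), Assembly (2993). DROPPED
2026-08-16 (route-repair, glue.unused-crux: a crux must feed a hypothesis of `closes (hX :
GalerkinSteadyZerothLaw) (hT : FixedViscosityTransfer) (hS : SteadyWeakIsGlobalLerayHopf)`; none of
the three does and no honest glue exists — each is a consequence of #2, an address for its witnesses
or a finite-N structure statement beside it, and a 'glue' `⋯ → TaylorGreenLoudGalerkinStates` would
only hide #2's difficulty): (i) TaylorGreenLogLoudStates (14586, log-energy rung): #2 ⇒ it and ¬it ⇒
¬#2 are LANDED (Theorems/TaylorGreenLogLoudStates/Negative/Ceilings.lean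
`logLoudStates_of_loudBoundedStates`, `not_loud_of_not_logLoud`), so it keeps both uses without
being an item — cheapest kill of #2 (K1/K2) and one-generation milestone (picked line `Sketch`, odd
Kerr–Dold wall rows in Fix K; lemmas land as `--supports` of #2); its chain record binds stub_froth:
O1 (triage r1-2) — the work of f on a flow-invariant torus of a smooth coarse flow is O(ν), so loud
steady witnesses need chaotic coarse streamlines through the cores; `vort_eq_zero_on_latticeLine`
(Negative/MirrorClass) — no vorticity ON the K-lattice lines in Fix K. (ii) LaminarNeverLoud (2988,
address: loud bounded points lie off the laminar component): numerically FALSE AS TYPED on the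
under-resolved diagonal (census kit j012527–j012531, Sabra shadow j009577, explorer j009026; triage
r1-2 misstatement alert, repair C′ = ν-before-N: ∃ν₀ ∀ν<ν₀ ∀ᶠN …); seven Negative/ files landed
(PowerBudget, StokesArc, Planar — planar analogue TRUE uniformly in N —, LoadBearing, Scaling,
Isolation, Uniqueness). For tenure: ¬C′ (a loud bounded laminar Galerkin point at arbitrarily small
ν for cofinitely many N) IS an instance of X via the coefficient/function dictionary — a genuine
alternative deciding crux ('anomaly reachable by continuation from Stokes'), not filed by this
repair seat. (iii) GenericRunawayStokesScaling (2990, Stokes rate for every runaway at regular g):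
presumably FALSE AS TYPED for N ≥ 3 — Beltrami-pair ruling g = Q_N(θ + w), θ ∈ F1⁺, w ∈ F2⁺: exact
frustrated ν ≡ 0 line with ONTO Jacobian (244/244 at N = 3, 512/512 at N = 4; exact mod-p
certificate, kit j011927/j012177/j014563), only global regularity uncertified; eight Negative/ files
landed (Frame, Deriv, ZeroViscosityLine, ResolutionOne, Critical, Helicity — the truncation
conserves helicity —, HelicitySqueeze, Cone); repaired form for a sibling route: hypothesis g ∉
J(Q_N) (Jelonek set) or EulerProperAt g. All three keep their ledger items, evidence and git
history; re-filing a repaired form is a tenure decision (in this route only if it enters the cone of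
`closes`).
KILL CRITERIA. (K1) ¬#2 ⇔ uniform-in-N laminarisation (not_crux_iff); the QUANTITATIVE kill we
pre-register: a steady log-ceiling ν‖∇U‖² ≤ C(E)/log(1/ν) for bounded steady (Galerkin) states —
refutes #2 and its log rung at once and would enter the barrier catalogue ("steady states are at
most log-loud"). (K2) the log rung refuted (¬LogLoudStates f_TG by any means, e.g. the log-ceiling
of K1; `not_loud_of_not_logLoud` landed) ⇒ #2 dead ⇒ one pre-registered force pivot (two-shear
Kolmogorov m = 2, detuned ABC) then close refuted. (K3) Window facts every witness meets (landed
Negative/): E ≥ 4ε², N ≥ (ε/4π²ν_jE)^{1/2}, shell-3 energy ≥ 4ε², half the dissipation at |k| >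
(ε/8π²ν_jE)^{1/2}; a census finding NO K-state with E ≤ 1, W ≥ 0.05 at N = 16, 24 for ν ∈ [0.002,
0.0144] (deflated Newton from ≥ 50 seeds + sheet-2 algebraic approximants + laminar continuation)
retires the adjacent-sheet address and demotes #2 to its log form. (K4) MirrorDisconnection refuted
at a regular value retires the organising principle (close superseded into CoherentStates). (K5)
SteadyNeg (0222) proved ⇒ ¬X via FixedViscosityTransfer.
NOT DECOMPOSED YET. #2 is not split into items — its one active decomposition is the registered stub
set of the picked line; moderate-ν Newton data (sheet jump, deflation), certified one-(ν,N)
milestones, the ν = 0 fibre (dodger pairs ±c*), σ-invariant isolas, the periodic mirror (u(t),ν) ↦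
(−u(−t),−ν), Puiseux/runaway profiles (former #5), the laminar-component address and its ν-before-N
repair (former #3′), the log-energy one-generation rung (former #3) and the index census (Σ ind = +1
at every (N, ν > 0)) are evidence or --supports lemmas, never items (the three dropped as cruxes
2026-08-16: outside the cone of `closes`).
CHEAPEST FALSIFIER. Continue the K-symmetric laminar TG branch in ν at N = 16/24/32 (JFNK +
arclength) from ν = 0.03 to 0.001, tracking (E, W = ν‖∇U‖², E/log(1/ν)) and running deflation at ν =
0.01, 0.006, 0.003: toy rungs N = 6, 8 (j005588, j005751) agree — no fold to ν = 1.46e-3, W = 0.34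
at E = 0.65, local slopes E ~ ν^{-1.0}, W ~ ν^{-0.5}; if at resolving N the branch keeps E ~ ν⁻¹ AND
nothing sits in the window, the log rung (hence #2, by `not_loud_of_not_logLoud`) and the sheet
address die together within a week of kit time.
NUMBERS. ‖f_TG‖₂² = 1/4; loudness (f,U) ≤ ½√E (sharp) ⇒ E ≥ 4ε²; resolution floor ε ≤ 4π²ν N²E;
laminar work W(ν) = 1/(48π²ν) = 0.211 at ν = 0.01 (Stokes) vs 0.170 Padé-summed (nonlinear regime
begins at ν_c = 0.0144, X_c = ν_c⁻⁴ ≈ 2.35e7, pair at X ≈ −2.34e7 ± 2.2e6 i); E(0.02) ≈ 0.043;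
Kolmogorov resolution k_η ≈ (ε/ν³)^{1/4}/2π ≈ 16 at (ν, ε) = (1.46e-3, 0.34).
SOURCES. Held and read: BergBredenLessardVeen2021 (arXiv 1902.00384 p.4, Thm 1.1),
GiraultRaviart1979 (galaxy panama:257311490703434, Ch. IV §2–3), KrasnoselskiiZabreiko1984,
ShuklaEtAl2019, Cheskidov2023 (2311.04182 p.4), CheskidovFriedlander2009, ClearyPage2025,
VanVeenKidaKawahara2006, KerrDold1994, Kerr2024, GallayWayne2006, GallayMaekawa2010, Palais1979,
book:basu2006, ConstantinFoias1988 (book:constantin1988). Wanted: BrezziRappazRaviart1980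
(acq-04727), BrachetEtAl1983 (want filed 2026-08-16).

Novelty: DELTA (one sentence): the mirror-doubled real-algebraic steady Galerkin variety (free involution
σ:(c,ν) ↦ (−c,−ν), lines vs isolas, odd crossings through dodger pairs, runaway = unforced
truncated-Euler profile, index census Σ ind = +1) COMBINED with Newton-data transfer in the mirror
class K (GiraultRaviart1979 Ch. IV Thm 3.3 with ν-independent constants) and the EXACT Reynolds
series of the single-shell Taylor–Green force (order = wavenumber ⇒ finite N is the PDE verbatim;
ν_c = 0.0144 and the complex branch pair computed, kit j009556) is a finder-plus-certifier
architecture for loud steady states that no searched source runs at the zeroth law. Claimed grade: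
new-combination (refuter audit -27-0 of the spine card, 2026-08-15T20:30Z, confirmed new-combination
and objected "σ is an identity, not an engine" — (L2) transfer-from-Newton-data and (L3)
exact-series finder are the engines added since; crux idea cards 2026-08-16:
reynolds-series-sheet-jump, index-census-persistence, onsager-sink-lattice, stagnation-plug-froth,
depth-dichotomy-lanford).
NEAREST PRIOR ART FOUND (searches 2026-08-15/16; searchd rc 75 ×2 this session, galaxy +
zbMATH/Crossref + held texts): (i) steady states of truncated NS followed in N —
FranceschiniTebaldiZironi1984 (fixed points of N-mode 2-D NS as N increases); generic finiteness at
fixed ν — FoiasTemam1977, SautTemam1980; (ii) branch-following in Re to (un)forced Euler limits —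
Okamoto1998, OkamotoShoji1993, Nagata1990, ClearyPage2025 (three fate  [refs: 10.1063/1.865025, 10.1137/S0036139994272261, paper:galaxy-pdf-946861120, doi:10.1063/1.865025, doi:10.1137/S0036139994272261, GiraultRaviart1979, FranceschiniTebaldiZironi1984, FoiasTemam1977, SautTemam1980, Okamoto1998, OkamotoShoji1993, Nagata1990, ClearyPage2025, ShuklaEtAl2019, BrezziRappazRaviart1980, KrasnoselskiiZabreiko1984, BergBredenLessardVeen2021, Watanabe2009, LiSinai2008, GallayWayne]

Barriers (technique_class: steady-states galerkin newton-kantorovich mirror tameness): - technique_class: steady-states galerkin newton-kantorovich mirror tameness (+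
symmetric-criticality, reynolds-series as sub-techniques)
- Literature.Barriers.AnomalousDissipation.AlexakisDoering2006_energyDissipationBound: hypothesis
violated = planarity (x₃-independence). Its ε ≲ U³ℓ⁻¹Re^{-1/2}-type bound covers exactly the
x₃-independent steady (Galerkin) states, so LaminarNeverLoud is automatic in 2-D and every witness
of X/#2/#3 must be genuinely 3-D; f_TG ∝ (…)·cos2πx₃ drives vortex stretching at the K-lattice
stagnation points. Caveat recorded: BergBredenLessardVeen2021's certified TG orbit IS planar — it is
precedent for the tool (L2), not for the regime.
- Literature.Barriers.AnomalousDissipation.Marchioro1986_globalAttraction: hypothesis violated =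
gravest-shell 2-D forcing (also its Galerkin/firstMode forms); there the Reynolds series terminates
at order 1 (one sheet, unique quiet laminar state, Stokes hyperbola a = 1), exactly what (L1)/(L3)
predict; f_TG lives on |k|² = 3 of T³ and is not Euler-steady.
- Literature.Barriers.AnomalousDissipation.DrivasEyink2019_lemma1_measurable: NOT evaded — necessary
signature: the steady limits u_j are uniformly Onsager-rough; at finite N half the dissipation sits
at |k| > (ε/8π²ν_jE)^{1/2} (landed high_mode_dissipation_floor) and Besov-1/3 norms blow up along j;
every kit census records spectral slopes (steeper than −5/3 uniformly ⇒ not a witness).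
- Literature.Barriers.AnomalousDissipation.DeRosaInversi2024_thm12: hypothesis

History (route lifecycle, newest last):
- 2026-08-16T03:42:04Z · AUTO-CRUX (backfill): GalerkinSteadyZerothLaw — hypotheses of the deciding theorem that nothing in the route derives are cruxes (operator:999:586464)
- 2026-08-16T06:23:31Z · rev 14: dropped TaylorGreenLogLoudStates, LaminarNeverLoud, GenericRunawayStokesScaling — route-repair (glue.unused-crux, D-0027 cone of closes): DROP TaylorGreenLogLoudStates (14586), LaminarNeverLoud (2988), GenericRunawayStokesScaling (2990) — non (planner-rrepair-AnomalousDissipation-MirrorVar-6deb5b25-0)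

sub-problem: AnomalousDissipation · status: open · opened planner-plancard-AnomalousDissipation-Anomalo-af983f66-0 2026-08-15T11:09:51Z · rev 16 · ledger route-AnomalousDissipation-MirrorVariety
GENERATED by the gate from the ledger (D-0016/17). Provers cite these decls: `theorem foo : Summit.AnomalousDissipation.AnomalousDissipation.Theses.MirrorVariety.<Decl> := …` in Summits/AnomalousDissipation/AnomalousDissipation/Theorems/<Name>.lean.
-/

namespace Summit.AnomalousDissipation.AnomalousDissipation.Theses.MirrorVariety

open scoped BigOperators Topology Manifold Classical MeasureTheory ProbabilityTheory Matrix InnerProductSpace ComplexConjugate ContinuousMap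
open Filter Set Function TopologicalSpace MeasureTheory

attribute [summit_statement] _root_.AnomalousDissipation

open Literature.Turb

/-- item stmt-AnomalousDissipation-2986 · crux (kind.auto-crux: conjecture-grade) · rank 0 · open · by planner
why it might fail: Summit-strength (X ⇒ SteadyZerothLaw(f) via FixedViscosityTransfer; ¬X if SteadyNeg 0222 holds); every computed steady branch laminarises (Cheskidov2023 p.4); at fixed N bounded states are quiet (ε ≤ 4π²νN²E): witnesses live at N ≳ (ε/νE)^½ with uniformly Onsager-rough limits.
sources: Temam1979, ConstantinFoias1988, GiraultRaviart1979, BrezziRappazRaviart1980, Cheskidov2023, AlexakisDoering2006PLA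
Thesis X (Galerkin steady zeroth law): a smooth div-free mean-zero steady force f on T³, viscosities
ν_j → 0⁺, constants E, ε > 0 such that for every j and for INFINITELY MANY resolutions N there is a
Fourier–Galerkin steady state U at (N, ν_j) — smooth, div-free, mean-zero, band-limited to the
punctured ball 0 < |k| ≤ N, solving the tested Galerkin equations ∫⟨U,(U·∇)a⟩ + ν_j⟨U,Δa⟩ + ⟨f,a⟩ =
0 for all band-limited smooth div-free a (verbatim the form produced by Literature
exists_steady_galerkin_approx / exists_steady_galerkin_limit) — with ∫|U|² ≤ E and ν_j‖∇U‖² ≥ ε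
(gradNormSq). Loud bounded points on the real-algebraic steady Galerkin varieties, at fixed
viscosity, at unbounded resolution. X → AnomalousDissipation through the supports
FixedViscosityTransfer + SteadyWeakIsGlobalLerayHopf (Assembly). Card:
Ideas/dodger-parity-negative-viscosity-mirror.md; Temam1979 Ch. II Thm 1.2; ConstantinFoias1988 Ch.
8 (8.3)–(8.7). -/
@[route_item "route-AnomalousDissipation-MirrorVariety", crux]
def GalerkinSteadyZerothLaw : Prop :=
  ∃ f : UnitAddTorus (Fin 3) → EuclideanSpace ℝ (Fin 3), Literature.Analysis.FunctionSpaces.Torus.IsSmooth f ∧ Literature.Analysis.FunctionSpaces.Torus.IsDivFree f ∧ Literature.Analysis.FunctionSpaces.Torus.HasZeroMean f ∧ ∃ (ν : ℕ → ℝ) (E ε : ℝ), (∀ j, 0 < ν j) ∧ Filter.Tendsto ν Filter.atTop (nhds 0) ∧ 0 < ε ∧ ∀ j, ∃ᶠ N in Filter.atTop, ∃ U : UnitAddTorus (Fin 3) → EuclideanSpace ℝ (Fin 3), (Literature.Analysis.FunctionSpaces.Torus.IsSmooth U ∧ Literature.Analysis.FunctionSpaces.Torus.IsDivFree U ∧ Literature.Analysis.FunctionSpaces.Torus.HasZeroMean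 U ∧ (∀ k ∉ (Literature.Analysis.FunctionSpaces.Torus.freqBall N).erase (0 : Fin 3 → ℤ), UnitAddTorus.mFourierCoeff (Literature.Analysis.FunctionSpaces.EuclideanSpace.complexify ∘ U) k = 0) ∧ ∀ a : UnitAddTorus (Fin 3) → EuclideanSpace ℝ (Fin 3), Literature.Analysis.FunctionSpaces.Torus.IsSmooth a → Literature.Analysis.FunctionSpaces.Torus.IsDivFree a → (∀ k ∉ (Literature.Analysis.FunctionSpaces.Torus.freqBall N).erase (0 : Fin 3 → ℤ), UnitAddTorus.mFourierCoeff (Literature.Analysis.FunctionSpaces.EuclideanSpace.complexify ∘ a) k = 0) → ∫ x, (inner ℝ (U x) (Literature.Analysis.FunctionSpaces.Torus.convect U a x) + ν j * inner ℝ (U x) (Literature.Analysis.FunctionSpaces.Torus.laplacian a x) + inner ℝ (f x) (a x)) = 0) ∧ ∫ x, ‖U x‖ ^ 2 ≤ E ∧ ε ≤ ν j * Literature.Analysis.FunctionSpaces.Torus.gradNormSq U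

/-- item stmt-AnomalousDissipation-2987 · crux · rank 2 · open · by planner
why it might fail: = steady zeroth law for f_TG in Newton-data form: one strained generation is only log-loud (D/E ≲ α/log(1/ν)), so stub_froth needs depth ≍ log(1/ν) with M_j²η_j → 0; K-cells may park on ν^½-quiet sheets (AlexakisDoering); steady tube arrays hold only for 19 ≲ Re ≲ 45 (AndreottiDouadyCouder1997).
sources: GiraultRaviart1979, BrezziRappazRaviart1980, BergBredenLessardVeen2021, Palais1979, GallayWayne2006, GallayMaekawa2010
For the Taylor–Green force f_TG(x) = (sin2πx₁ cos2πx₂ cos2πx₃, −cos2πx₁ sin2πx₂ cos2πx₃, 0) on the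
unit torus (written with fourier 1 (x i); the steady TG forcing of DNS and dynamo studies,
BrachetEtAl1983, PontyEtAl2005; smooth, div-free, mean-zero, genuinely three-dimensional — vortex
stretching, outside the Alexakis–Doering planar class) there are ν_j → 0⁺ and E, ε > 0 with loud
bounded Galerkin steady states (tested form as in the target, ∫|U|² ≤ E, ν_j‖∇U‖² ≥ ε) at ALL large
resolutions N. Implies the target (∀ᶠ ⇒ ∃ᶠ). The amplitude of the force is immaterial (scaling u ↦
αu, ν ↦ αν, f ↦ α²f). Evidence protocol (kit compute, attached as evidence, not an item):
Newton–Krylov / pseudo-arclength continuation in ν of steady truncated TG states at N = 2…8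
(TG-symmetric subspace first, then symmetry-broken), tracking (Σ|c_k|², ν·4π²Σ|k|²|c_k|²) along
every branch, including through ν = 0 (the mirror); a loud state certified at one (ν, N) by interval
Newton plus nondegeneracy propagates to all larger N (BrezziRappazRaviart1980) and, by
FixedViscosityTransfer-type compactness, to a true steady state at that ν — a milestone, not a
proof. Sources: BrachetEtAl1983 (TG vortex), PontyEtAl2 -/
@[route_item "route-AnomalousDissipation-MirrorVariety"]
def TaylorGreenLoudGalerkinStates : Prop :=
  ∀ f : UnitAddTorus (Fin 3) → EuclideanSpace ℝ (Fin 3), f = (fun x => !₂[(fourier 1 (x 0) : ℂ).im * (fourier 1 (x 1) : ℂ).re * (fourier 1 (x 2) : ℂ).re, -((fourier 1 (x 0) : ℂ).re * (fourier 1 (x 1) : ℂ).im * (fourier 1 (x 2) : ℂ).re), (0 : ℝ)]) → ∃ (ν : ℕ → ℝ) (E ε : ℝ), (∀ j, 0 < ν j) ∧ Filter.Tendsto ν Filter.atTop (nhds 0) ∧ 0 < ε ∧ ∀ j, ∀ᶠ N in Filter.atTop, ∃ U : UnitAddTorus (Fin 3) → EuclideanSpace ℝ (Fin 3), (Literature.Analysis.FunctionSpaces.Torus.IsSmooth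 U ∧ Literature.Analysis.FunctionSpaces.Torus.IsDivFree U ∧ Literature.Analysis.FunctionSpaces.Torus.HasZeroMean U ∧ (∀ k ∉ (Literature.Analysis.FunctionSpaces.Torus.freqBall N).erase (0 : Fin 3 → ℤ), UnitAddTorus.mFourierCoeff (Literature.Analysis.FunctionSpaces.EuclideanSpace.complexify ∘ U) k = 0) ∧ ∀ a : UnitAddTorus (Fin 3) → EuclideanSpace ℝ (Fin 3), Literature.Analysis.FunctionSpaces.Torus.IsSmooth a → Literature.Analysis.FunctionSpaces.Torus.IsDivFree a → (∀ k ∉ (Literature.Analysis.FunctionSpaces.Torus.freqBall N).erase (0 : Fin 3 → ℤ), UnitAddTorus.mFourierCoeff (Literature.Analysis.FunctionSpaces.EuclideanSpace.complexify ∘ a) k = 0) → ∫ x, (inner ℝ (U x) (Literature.Analysis.FunctionSpaces.Torus.convect U a x) + ν j * inner ℝ (U x) (Literature.Analysis.FunctionSpaces.Torus.laplacian a x) + inner ℝ (f x) (a x)) = 0) ∧ ∫ x, ‖U x‖ ^ 2 ≤ E ∧ ε ≤ ν j * Literature.Analysis.FunctionSpaces.Torus.gradNormSq U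

/-- item stmt-AnomalousDissipation-18425 · crux · rank 3 · open · by planner
why it might fail: Depletion along the branch: gauged loudness floor of the coat families fell 0.4→0.12–0.17 from N=8 to 10 (kit j016174/5); a steady log-ceiling ν‖∇U‖²≤C(E)/log(1/ν) (kill K1) or frustrated Euler–Galerkin states B_N(c,c)=C_N connected to laminar give quiet bounded states in Comp_N at ν≫N⁻².
sources: AlexakisDoering2006PLA, DoeringFoias2002, Cheskidov2023, Temam1979, VanVeenGoto2016, Frisch1995
[crux] NON-DEPLETION — a-priori estimate (split child 2 of GalerkinSteadyZerothLaw; strategist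
BC2-redirect 2026-08-17). Same objects as CellLaminarComponentReachesZero (cell force C, class Fix
τ, F_N(E), laminar anchor, Comp_N(E,ν₀)). CLAIM: for all E and ν₀ > 0 there are ν₁, ε > 0, a
resolution constant κ and N₁ such that for every N ≥ N₁ every state (c,ν) ∈ Comp_N(E,ν₀) with κ/N² ≤
ν ≤ ν₁ has dissipation ν·4π²Σ|k|²‖c_k‖² ≥ ε: within bounded energy the laminar component stays LOUD
down to zero viscosity, uniformly in N, in the RESOLVED WINDOW ν ≥ κ/N² (below it the landed
resolution_floor ε ≤ 4π²νN²E forbids loud bounded states, so nothing is claimed there). NO EXISTENCE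
is asserted (L ⇏ X; L is vacuous wherever the component does not reach; probes L→X, L→S fail). Why
plausible: on F_N(E) power = dissipation = Re Σ⟨C_k, c_k⟩ (Temam Ch. II (1.29); landed
`dissipation_eq_power`) equals E_C/(8π²ν) on the laminar arc (over-loud), so quiet bounded states
must be far from laminar; in Fix τ planar steady states are exactly laminar (2-D enstrophy identity
with all planar τ-even |k|² ≥ 2), so the Alexakis–Doering quiet planar branch (the τ-odd rung
ν≈0.0091) is absent BY SYMMETRY; the phy -/
@[route_item "route-AnomalousDissipation-MirrorVariety"]
def CellLaminarComponentStaysLoud : Prop :=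
  ∀ C : (Fin 3 → ℤ) → EuclideanSpace ℂ (Fin 3), C = (fun l : Fin 3 → ℤ => if l ∈ Fintype.piFinset ![({1, -1} : Finset ℤ), {1, -1}, {0}] then (Complex.I * (l 0 : ℂ) * (l 1 : ℂ) / 4) • !₂[-((l 1 : ℤ) : ℂ), ((l 0 : ℤ) : ℂ), 0] else 0) → ∀ E ν₀ : ℝ, 0 < ν₀ → ∃ ν₁ ε κ : ℝ, 0 < ν₁ ∧ 0 < ε ∧ ∃ N₁ : ℕ, ∀ N : ℕ, N₁ ≤ N → ∀ S : Finset (Fin 3 → ℤ), S = (Literature.Analysis.FunctionSpaces.Torus.freqBall N).erase (0 : Fin 3 → ℤ) → ∀ F : Set ((↥S → EuclideanSpace ℂ (Fin 3)) × ℝ), F = {z | z.1 ∈ Literature.Analysis.FluidPDE.galerkinSubspace S ∧ (∀ k : ↥S, Odd ((k : Fin 3 → ℤ) 0 + (k : Fin 3 → ℤ) 1) → z.1 k = 0) ∧ 0 < z.2 ∧ Literature.Analysis.FluidPDE.galerkinRHS S z.2 (fun k : ↥S => C k) z.1 = 0 ∧ ∑ k : ↥S, ‖z.1 k‖ ^ 2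 ≤ E} → ∀ z ∈ connectedComponentIn F ((fun k : ↥S => (8 * Real.pi ^ 2 * ν₀)⁻¹ • C k), ν₀), κ / (N : ℝ) ^ 2 ≤ z.2 → z.2 ≤ ν₁ → ε ≤ z.2 * (4 * Real.pi ^ 2 * ∑ k : ↥S, Literature.Analysis.FunctionSpaces.Torus.freqNormSq (k : Fin 3 → ℤ) * ‖z.1 k‖ ^ 2)

/-- item stmt-AnomalousDissipation-18419 · crux · rank 4 · open · by planner
why it might fail: Every τ-even 3-D branch may fold back to laminar or run away in energy (E~ν⁻¹, unforced truncated-Euler profile) before ν→0, or reach small ν only with N-dependent energy (coat families: E_max 1.6 at N=8 vs 5.9 at N=10, kit j016174/5): Comp_N(E,ν₀)⊆{ν≥ν_*(E)} for large N.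
sources: Rabinowitz1971, KrasnoselskiiZabreiko1984, Temam1979, SippJacquin1998, Thess1992, ClearyPage2025
[crux] REACHABILITY — topology / global continuation (split child 1 of GalerkinSteadyZerothLaw;
strategist BC2-redirect 2026-08-17). OBJECT: the cell force f_cell = (sin2πx cos2πy, −cos2πx sin2πy,
0) (Fourier family C = the explicit lambda = Theorems `cellCoeff` on the shell (±1,±1,0): exact
Euler core, Stokes eigenfield −Δf = 8π²f, ∫|f|² = ½; laminar steady state f/(8π²ν) at every Galerkin
level N ≥ 2) and the fundamental symmetry class Fix τ, τ:(x,y,z)↦(x+½,y+½,z) = coefficient vectors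
vanishing at every k with k₀+k₁ odd — an invariant subspace that contains EVERY three-dimensional
steady bifurcation of the laminar state and excludes the planar one (kit j021913, rungs of the
linearisation at laminar by vertical wavenumber m and τ-parity, N = 4…16: 3-D rungs all τ-even, m=1
ν=0.00528, m=2 ν=0.00691 (top; E_lam = 1.68), m=3 0.00471, m=4 0.00382 at N=16, N-converged; the
only τ-odd rung is planar, m=0, ν=0.00909; m=0 τ-even: none — planar τ-even steady states are
exactly laminar by the 2-D enstrophy identity Σ|k|²(|k|²−2)|c_k|²=0). F_N(E) := {(c,ν) : c ∈
galerkinSubspace(modes N) ∩ Fix τ, 0 < ν, galerkinRHS (modes N) ν C c = 0, Σ‖c_k‖² ≤ E};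
Comp_N(E,ν₀) := connectedComponentIn F_N( -/
@[route_item "route-AnomalousDissipation-MirrorVariety"]
def CellLaminarComponentReachesZero : Prop :=
  ∀ C : (Fin 3 → ℤ) → EuclideanSpace ℂ (Fin 3), C = (fun l : Fin 3 → ℤ => if l ∈ Fintype.piFinset ![({1, -1} : Finset ℤ), {1, -1}, {0}] then (Complex.I * (l 0 : ℂ) * (l 1 : ℂ) / 4) • !₂[-((l 1 : ℤ) : ℂ), ((l 0 : ℤ) : ℂ), 0] else 0) → ∃ E ν₀ : ℝ, 0 < ν₀ ∧ ∀ ν₁ : ℝ, 0 < ν₁ → ∃ᶠ N in Filter.atTop, ∀ S : Finset (Fin 3 → ℤ), S = (Literature.Analysis.FunctionSpaces.Torus.freqBall N).erase (0 : Fin 3 → ℤ) → ∀ F : Set ((↥S → EuclideanSpace ℂ (Fin 3)) × ℝ), F = {z | z.1 ∈ Literature.Analysis.FluidPDE.galerkinSubspace S ∧ (∀ k : ↥S, Odd ((k : Fin 3 → ℤ) 0 + (k : Fin 3 → ℤ) 1) → z.1 k = 0) ∧ 0 < z.2 ∧ Literature.Analysis.FluidPDE.galerkinRHS S z.2 (fun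 k : ↥S => C k) z.1 = 0 ∧ ∑ k : ↥S, ‖z.1 k‖ ^ 2 ≤ E} → ∃ z ∈ connectedComponentIn F ((fun k : ↥S => (8 * Real.pi ^ 2 * ν₀)⁻¹ • C k), ν₀), z.2 ≤ ν₁

/-- item stmt-AnomalousDissipation-15060 · crux · rank 5 · open · by operator
why it might fail: restored: kill witness landed in tree; the crux is the antecedent of a ¬H lemma for a closes hypothesis
sources: rebadge-audit
[crux] LOG-LOUD TAYLOR–GREEN GALERKIN STATES (rung 1 of crux #2 and implied by it): for f_TG there
are ν_j → 0⁺ (ν_j ≤ ¼) and E, c > 0 such that for every j and all large N there is an admissible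
Galerkin steady state (the bracket of #2 verbatim) with ∫|U|² ≤ E·log(1/ν_j) and ν_j‖∇U‖² ≥ c.
Intended witness: the ONE-GENERATION stretched-vortex skeleton in the mirror class K — Burgers-type
tubes/rings of circulation Γ ≍ 1 held at the K-lattice hyperbolic stagnation lines of the
Taylor–Green cell flow (strain α ≍ 1): dissipation αΓ²L/8π per unit length is ν-INDEPENDENT while
energy Γ²L·log(ℓ/δ)/4π, δ = (ν/α)^½, is log-divergent (Frisch1995 §8.9.1 (8.140); JerrardSeis2016
p.6; MoffattKidaOhkitani1994 large-Re asymptotics), made steady states for all large N by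
stub_galerkinNewton (GiraultRaviart1979 Ch. IV Thm 3.3 in Fix K) + stub_criticality (Palais1979).
Sibling normalisation of FrozenK41.SteadyLogWeak (stmt-AnomalousDissipation-1214: bounded energy,
dissipation ≥ c/log(1/ν)). ROLE IN THE ROUTE: refuted ⇒ #2 TaylorGreenLoudGalerkinStates is dead
(cheapest substantive kill of the deciding crux: bounded energy implies energy ≤ E·log(1/ν_j) once
ν_j ≤ 1/e); proved ⇒ the first steady Nav -/
@[route_item "route-AnomalousDissipation-MirrorVariety", crux]
def TaylorGreenLogLoudStates : Prop :=
  ∀ f : UnitAddTorus (Fin 3) → EuclideanSpace ℝ (Fin 3), f = (fun x => !₂[(fourier 1 (x 0) : ℂ).im * (fourier 1 (x 1) : ℂ).re * (fourier 1 (x 2) : ℂ).re, -((fourier 1 (x 0) : ℂ).re * (fourier 1 (x 1) : ℂ).im * (fourier 1 (x 2) : ℂ).re), (0 : ℝ)]) → ∃ (ν : ℕ → ℝ) (E c : ℝ), (∀ j, 0 < ν j ∧ ν j ≤ 1 / 4) ∧ Filter.Tendsto ν Filter.atTop (nhds 0) ∧ 0 < c ∧ ∀ j, ∀ᶠ N in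 Filter.atTop, ∃ U : UnitAddTorus (Fin 3) → EuclideanSpace ℝ (Fin 3), (Literature.Analysis.FunctionSpaces.Torus.IsSmooth U ∧ Literature.Analysis.FunctionSpaces.Torus.IsDivFree U ∧ Literature.Analysis.FunctionSpaces.Torus.HasZeroMean U ∧ (∀ k ∉ (Literature.Analysis.FunctionSpaces.Torus.freqBall N).erase (0 : Fin 3 → ℤ), UnitAddTorus.mFourierCoeff (Literature.Analysis.FunctionSpaces.EuclideanSpace.complexify ∘ U) k = 0) ∧ ∀ a : UnitAddTorus (Fin 3) → EuclideanSpace ℝ (Fin 3), Literature.Analysis.FunctionSpaces.Torus.IsSmooth a → Literature.Analysis.FunctionSpaces.Torus.IsDivFree a → (∀ k ∉ (Literature.Analysis.FunctionSpaces.Torus.freqBall N).erase (0 : Fin 3 → ℤ), UnitAddTorus.mFourierCoeff (Literature.Analysis.FunctionSpaces.EuclideanSpace.complexify ∘ a) k = 0) → ∫ x, (inner ℝ (U x) (Literature.Analysis.FunctionSpaces.Torus.convect U a x) + ν j * inner ℝ (U x) (Literature.Analysis.FunctionSpaces.Torus.laplacian a x) + inner ℝ (f x) (a x)) = 0) ∧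 ∫ x, ‖U x‖ ^ 2 ≤ E * Real.log (1 / ν j) ∧ c ≤ ν j * Literature.Analysis.FunctionSpaces.Torus.gradNormSq U

/-- item stmt-AnomalousDissipation-2989 · support · rank 4 · closed · proved by Summit.AnomalousDissipation.AnomalousDissipation.Theorems.mirrorDisconnection_proof (prover) · by planner
why it might fail: False at critical values (g = 0: the axis c = 0 joins ν = ±∞ through the σ-fixed point (0,0); symmetric forces with pitchforks); the Lean proof needs the classification of non-compact connected 1-manifolds (MilnorTDV1965 appendix), absent from Mathlib, or a direct order argument along the curve.
sources: MilnorTDV1965, book:basu2006-algorithms-real-algebraic-geometry, FoiasTemam1977, SautTemam1980, OkamotoShoji1993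
The card's backbone as a theorem (finite N, provable now in principle). At every resolution N (S =
punctured ball) and for every nonzero real solenoidal force vector g ∈ galerkinSubspace S that is a
REGULAR VALUE of F(c, ν) = galerkinRHS S ν g c on galerkinSubspace S × ℝ (hypothesis: at every zero,
DF maps galerkinSubspace S × ℝ onto galerkinSubspace S), every point z of V = F⁻¹(0) ∩
(galerkinSubspace S × ℝ) has a compact connected component, or a component NOT containing −z = σz.
Proof sketch: F∘σ = F for σ(c, ν) = (−c, −ν) (convectionCoeff is even in c, the Stokes term is
bilinear in (ν, c)), so σ preserves V; σ has no fixed point on V because F(0,0) = leraySym g = g ≠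
0; regular value ⇒ V is a closed embedded 1-submanifold, each component a line or a circle
(MilnorTDV1965, appendix; finitely many components since V is real-algebraic, BPR Thm 5.21–5.22 =
book:basu2006 pp.215–216); a σ-invariant line would carry a continuous involution of ℝ exchanging
its two ends, which has a fixed point — contradiction. COROLLARY (to be filed as support once this
lands): with the exact properness identity |ν|·4π²Σ|k|²|c_k|² = |Re⟨g, c⟩| ≤ ‖g‖‖c‖
(galerkin_energy_eq_of_galerkinRHS_eq_zero) and un -/
@[route_item "route-AnomalousDissipation-MirrorVariety"]
def MirrorDisconnection : Prop :=
  ∀ (N : ℕ) (S : Finset (Fin 3 → ℤ)), S = (Literature.Analysis.FunctionSpaces.Torus.freqBall N).erase 0 → ∀ g : ↥S → EuclideanSpace ℂ (Fin 3), g ∈ Literature.Analysis.FluidPDE.galerkinSubspace S → g ≠ 0 → ∀ V : Set ((↥S → EuclideanSpace ℂ (Fin 3)) × ℝ), V = {z | z.1 ∈ Literature.Analysis.FluidPDE.galerkinSubspace S ∧ Literature.Analysis.FluidPDE.galerkinRHS S z.2 g z.1 = 0} → (∀ z ∈ V, ∀ w ∈ Literature.Analysis.FluidPDE.galerkinSubspace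 S, ∃ v ∈ Literature.Analysis.FluidPDE.galerkinSubspace S, ∃ t : ℝ, fderiv ℝ (fun p : (↥S → EuclideanSpace ℂ (Fin 3)) × ℝ => Literature.Analysis.FluidPDE.galerkinRHS S p.2 g p.1) z (v, t) = w) → ∀ z ∈ V, IsCompact (connectedComponentIn V z) ∨ -z ∉ connectedComponentIn V z

/-- item stmt-AnomalousDissipation-14162 · support · rank 9 · closed · proved by Summit.AnomalousDissipation.AnomalousDissipation.Theorems.taylorGreenFeedsTarget_proof @ eba589e1b6d9 (prover) · by planner
sources: BrachetEtAl1983, Temam1979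
[support] Glue crux #2 → target X (route-choice repair 2026-08-16, option (a): makes the target
GalerkinSteadyZerothLaw reachable from the crux list): TaylorGreenLoudGalerkinStates →
GalerkinSteadyZerothLaw. Provable NOW, about ten lines, from landed tree material: instantiate the
crux at its own force f := f_TG (`Theorems/TaylorGreenLoudGalerkinStates/Negative/LoadBearing.lean`
`Negative.tgForce`, definitionally the crux's lambda — `Negative.crux_iff` is proved with `rfl`),
which is smooth, divergence-free and mean-zero by the LANDED lemmas `Negative.isSmooth_tgForce`,
`Negative.isDivFree_tgForce`, `Negative.hasZeroMean_tgForce`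
(`Theorems/TaylorGreenLoudGalerkinStates/Negative/Anatomy.lean`: f_TG is the explicit real
trigonometric polynomial `tgForce_eq_realTrigPoly` on the shell |k|² = 3, 0 ∉ shell); keep ν, E, ε
verbatim; `∀ᶠ N in atTop` ⇒ `∃ᶠ N in atTop` is `Filter.Eventually.frequently` (atTop on ℕ is NeBot).
The state bracket, energy bound and loudness clause of crux and target are syntactically identical,
so no analysis is involved (planner Sketch.lean: the term ⟨tgForce, isSmooth_tgForce,
isDivFree_tgForce, hasZeroMean_tgForce, ν, E, ε, hν, hν0, hε, fun j => (hloud j).freq -/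
@[route_item "route-AnomalousDissipation-MirrorVariety"]
def TaylorGreenFeedsTarget : Prop :=
  TaylorGreenLoudGalerkinStates → GalerkinSteadyZerothLaw

/-- item stmt-AnomalousDissipation-14587 · support · rank 9 · closed · proved by Summit.AnomalousDissipation.AnomalousDissipation.Theorems.eigenforceWorkIdentity_proof (prover) · by planner
sources: Temam1979, BrachetEtAl1983
[support] EIGENFORCE WORK IDENTITY (first lemma of the finder/census engine (L3); provable now,
S–M): for N ≥ 2 every admissible Galerkin steady Taylor–Green state U at (N, ν) satisfies
12π²ν∫⟨f_TG,U⟩ = ¼ + ∫⟨U,(U·∇)f_TG⟩ — test the Galerkin equations with a := f_TG (admissible: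
smooth, div-free, band-limited for N ≥ 2 since its shell |k|² = 3 ≤ N²), use Δf_TG = −12π²f_TG
(Stokes eigenfield) and ∫|f_TG|² = ¼ (landed Negative.integral_norm_sq_tgForce,
Theorems/TaylorGreenLoudGalerkinStates/Negative/Anatomy.lean) — and ∫⟨f_TG,U⟩ = ν‖∇U‖² (test a := U;
verbatim the landed Negative.energy_identity). Corollaries to ride as --supports:
LoudIffTransferDeficit (ε ≤ ν‖∇U‖² ↔ 12π²νε − ¼ ≤ ∫⟨U,(U·∇)f_TG⟩): the nonlinear flux out of the
forcing shell of EVERY bounded steady TG state is pinned to ¼ + O(ν√E), loud/quiet is decided in the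
O(ν) layer by one cubic functional — the cheapest invariant to track along sheets and in every
census. Sources: Temam1979 Ch. II (1.25)/(1.29); crux card
Cruxes/TaylorGreenLoudGalerkinStates/Ideas/reynolds-series-sheet-jump.md (First lemma, P1).
[difficulty: S] -/
@[route_item "route-AnomalousDissipation-MirrorVariety"]
def EigenforceWorkIdentity : Prop :=
  ∀ f : UnitAddTorus (Fin 3) → EuclideanSpace ℝ (Fin 3), f = (fun x => !₂[(fourier 1 (x 0) : ℂ).im * (fourier 1 (x 1) : ℂ).re * (fourier 1 (x 2) : ℂ).re, -((fourier 1 (x 0) : ℂ).re * (fourier 1 (x 1) : ℂ).im * (fourier 1 (x 2) : ℂ).re), (0 : ℝ)]) → ∀ (ν : ℝ) (N : ℕ) (U : UnitAddTorus (Fin 3) → EuclideanSpace ℝ (Fin 3)), 2 ≤ N → (Literature.Analysis.FunctionSpaces.Torus.IsSmooth U ∧ Literature.Analysis.FunctionSpaces.Torus.IsDivFree U ∧ Literature.Analysis.FunctionSpaces.Torus.HasZeroMean U ∧ (∀ k ∉ (Literature.Analysis.FunctionSpaces.Torus.freqBall N).erase (0 : Fin 3 → ℤ), UnitAddTorus.mFourierCoeff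 (Literature.Analysis.FunctionSpaces.EuclideanSpace.complexify ∘ U) k = 0) ∧ ∀ a : UnitAddTorus (Fin 3) → EuclideanSpace ℝ (Fin 3), Literature.Analysis.FunctionSpaces.Torus.IsSmooth a → Literature.Analysis.FunctionSpaces.Torus.IsDivFree a → (∀ k ∉ (Literature.Analysis.FunctionSpaces.Torus.freqBall N).erase (0 : Fin 3 → ℤ), UnitAddTorus.mFourierCoeff (Literature.Analysis.FunctionSpaces.EuclideanSpace.complexify ∘ a) k = 0) → ∫ x, (inner ℝ (U x) (Literature.Analysis.FunctionSpaces.Torus.convect U a x) + ν * inner ℝ (U x) (Literature.Analysis.FunctionSpaces.Torus.laplacian a x) + inner ℝ (f x) (a x)) = 0) → 12 * Real.pi ^ 2 * ν * ∫ x, inner ℝ (f x) (U x) = 1 / 4 + ∫ x, inner ℝ (U x) (Literature.Analysis.FunctionSpaces.Torus.convect U f x) ∧ ∫ x, inner ℝ (f x) (U x) = ν * Literature.Analysis.FunctionSpaces.Torus.gradNormSq U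

/-- item stmt-AnomalousDissipation-18439 · support · rank 9 · closed · proved by Summit.AnomalousDissipation.AnomalousDissipation.Theorems.galerkinSteadyZerothLawOfSplit_proof @ cda827de3ac2 (prover) · by planner
sources: Temam1979, Rabinowitz1971
[support] GLUE of the strategist's decomposition of GalerkinSteadyZerothLaw (BC2 redirect,
2026-08-17): CellLaminarComponentReachesZero → CellLaminarComponentStaysLoud →
GalerkinSteadyZerothLaw. PROVED and kernel-checked (planner folder Split.lean, lean check rc0, 0
sorry, axioms propext/Classical.choice/Quot.sound; attached as evidence on
stmt-AnomalousDissipation-2986; registered line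
Cruxes/GalerkinSteadyZerothLaw/Lines/laminar_component_split.lean, composition
GalerkinSteadyZerothLaw_of). Provable NOW by any prover in two steps: land the evidence file
verbatim as Theorems/MirrorVarietyGalerkinSteadyZerothLawSplit.lean (--supports
stmt-AnomalousDissipation-2986), then close this item by the one-liner
`galerkinSteadyZerothLaw_of_subs` (the route-context children unfold to its hypotheses by delta only
— DefeqCheck.lean rc0). Proof content (~75 lines): E, ν₀ from R; ν₁, ε, κ, N₁ from L at (E, ν₀); ν_j
:= min ν₁ ν₀/(j+2); per j, R at threshold ν_j holds frequently in N, intersected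
(Frequently.and_eventually) with N ≥ N₁, N ≥ 2, κ/N² ≤ ν_j; IVT on the viscosity projection of the
preconnected component (anchor above ν_j, R's state below) gives a state EXACTLY at ν_j; membership
gives -/
@[route_item "route-AnomalousDissipation-MirrorVariety"]
def GalerkinSteadyZerothLawOfSplit : Prop :=
  CellLaminarComponentReachesZero → CellLaminarComponentStaysLoud → GalerkinSteadyZerothLaw

/-- item stmt-AnomalousDissipation-2991 · support · rank 9 · closed · proved by Summit.AnomalousDissipation.AnomalousDissipation.Theorems.FixedViscosityTransfer_proof (prover) · by planner
sources: Temam1979, ConstantinFoias1988, RobinsonRodrigoSadowski2016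
Assembly glue, provable now from tree material. Fixed ν > 0, f smooth div-free mean-zero: if for
infinitely many N there are Galerkin steady states U_N (tested form of
SteadyGalerkinApprox.exists_steady_galerkin_approx) with ∫|U_N|² ≤ E and ν‖∇U_N‖² ≥ ε, then some u ∈
H with u ∈ V (energySpaceV) is a steady weak solution (Torus.IsSteadyWeakSolution ν f u) with ∫|u|²
≤ E, (f, u) ≥ ε (Torus.pairing) and the energy equation ν‖∇u‖² = (f, u) (hence ν‖∇u‖² ≥ ε). Proof =
Temam1979 Ch. II Thm 1.2 part (ii) run on THESE zeros instead of the Brouwer ones: testing with a =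
U_N gives the Galerkin energy identity ν‖∇U_N‖² = (f, U_N) ≤ ‖f‖√E, a uniform H¹ bound; extract a
coefficientwise convergent subsequence and get U_N → u strongly in L² (reuse
exists_subseq_tendsto_of_norm_le, exists_realField_of_tsum_lt_top,
tendsto_lintegral_enorm_sub_sq_of_tendsto_mFourierCoeff from SteadyNavierStokesLimit; identify the
limit as a steady weak solution in V exactly as
SteadyNavierStokesProofs.exists_mem_energySpaceV_isSteadyWeakSolution /
tendsto_integral_weakForm_fourierTruncate); ∫|u|² ≤ E and (f, U_N) → (f, u) by strong L²
convergence, with (f, U_N) = ν‖∇U_N‖² ≥ ε; the energy equation of the limit is th -/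
@[route_item "route-AnomalousDissipation-MirrorVariety", crux]
def FixedViscosityTransfer : Prop :=
  ∀ (ν E ε : ℝ) (f : UnitAddTorus (Fin 3) → EuclideanSpace ℝ (Fin 3)), 0 < ν → Literature.Analysis.FunctionSpaces.Torus.IsSmooth f → Literature.Analysis.FunctionSpaces.Torus.IsDivFree f → Literature.Analysis.FunctionSpaces.Torus.HasZeroMean f → (∃ᶠ N in Filter.atTop, ∃ U : UnitAddTorus (Fin 3) → EuclideanSpace ℝ (Fin 3), (Literature.Analysis.FunctionSpaces.Torus.IsSmooth U ∧ Literature.Analysis.FunctionSpaces.Torus.IsDivFree U ∧ Literature.Analysis.FunctionSpaces.Torus.HasZeroMean U ∧ (∀ k ∉ (Literature.Analysis.FunctionSpaces.Torus.freqBall N).erase (0 : Fin 3 → ℤ), UnitAddTorus.mFourierCoeff (Literature.Analysis.FunctionSpaces.EuclideanSpace.complexify ∘ U) k = 0) ∧ ∀ a : UnitAddTorus (Fin 3) → EuclideanSpace ℝ (Fin 3), Literature.Analysis.FunctionSpaces.Torus.IsSmooth a → Literature.Analysis.FunctionSpaces.Torus.IsDivFree a → (∀ k ∉ (Literature.Analysis.FunctionSpaces.Torus.freqBall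 N).erase (0 : Fin 3 → ℤ), UnitAddTorus.mFourierCoeff (Literature.Analysis.FunctionSpaces.EuclideanSpace.complexify ∘ a) k = 0) → ∫ x, (inner ℝ (U x) (Literature.Analysis.FunctionSpaces.Torus.convect U a x) + ν * inner ℝ (U x) (Literature.Analysis.FunctionSpaces.Torus.laplacian a x) + inner ℝ (f x) (a x)) = 0) ∧ ∫ x, ‖U x‖ ^ 2 ≤ E ∧ ε ≤ ν * Literature.Analysis.FunctionSpaces.Torus.gradNormSq U) → ∃ u : ↥(Literature.Analysis.FunctionSpaces.Torus.energySpace (Fin 3)), (u : MeasureTheory.Lp (EuclideanSpace ℝ (Fin 3)) 2 (MeasureTheory.volume : MeasureTheory.Measure (UnitAddTorus (Fin 3)))) ∈ Literature.Analysis.FunctionSpaces.Torus.energySpaceV (Fin 3) ∧ Literature.Analysis.FluidPDE.Torus.IsSteadyWeakSolution ν f u ∧ ∫ x, ‖(u : MeasureTheory.Lp (EuclideanSpace ℝ (Fin 3)) 2 (MeasureTheory.volume : MeasureTheory.Measure (UnitAddTorus (Fin 3)))) x‖ ^ 2 ≤ E ∧ ε ≤ Literature.Analysis.FluidPDE.Torus.pairing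 (u : MeasureTheory.Lp (EuclideanSpace ℝ (Fin 3)) 2 (MeasureTheory.volume : MeasureTheory.Measure (UnitAddTorus (Fin 3)))) f ∧ ν * (Literature.Analysis.FunctionSpaces.Torus.eGradNormSq ((u : MeasureTheory.Lp (EuclideanSpace ℝ (Fin 3)) 2 (MeasureTheory.volume : MeasureTheory.Measure (UnitAddTorus (Fin 3)))) : UnitAddTorus (Fin 3) → EuclideanSpace ℝ (Fin 3))).toReal = Literature.Analysis.FluidPDE.Torus.pairing (u : MeasureTheory.Lp (EuclideanSpace ℝ (Fin 3)) 2 (MeasureTheory.volume : MeasureTheory.Measure (UnitAddTorus (Fin 3)))) f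

/-- item stmt-AnomalousDissipation-2992 · support · rank 9 · closed · proved by Summit.AnomalousDissipation.AnomalousDissipation.Theorems.steadyWeakIsGlobalLerayHopf_proof (prover) · by planner
sources: Galdi2000, DoeringFoias2002, RobinsonRodrigoSadowski2016
Assembly glue, provable now. A steady weak solution u ∈ V (ν > 0, f smooth with ∫ f = 0) satisfying
the energy equation ν‖∇u‖² = (f, u), viewed as the constant path t ↦ u (the Lp representative), is a
global Leray–Hopf solution from u (Torus.IsGlobalLerayHopf ν (fun _ => f) u (fun _ => u)): weak form
— for a space-time test ψ supported in [0,T) the time-derivative term integrates to −∫⟨u, ψ 0⟩ and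
cancels the datum term, and each slice term vanishes by the steady weak form, extended from
mean-zero div-free tests to all smooth div-free tests using ∫ f = 0 and ∫ (u⊗u):∇(const) = 0 = ∫⟨u,
Δ const⟩; the energy inequalities hold with EQUALITY from ν‖∇u‖² = (f, u) (both sides linear in t);
energy_bound/memLp from u ∈ L²; memL2Sobolev from u ∈ V; weak continuity and strong attainment of
the datum are trivial for a constant path; measurability of stLift of a constant path. Moreover
meanEnergy (fun _ => u) = ∫|u|² and meanDissipation ν (fun _ => u) = ν‖∇u‖² (timeMean of a constant
c is c for T ≠ 0; limsup along atTop of an eventually constant function; cf. LongTimeAveragePeriodic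
for the periodic case and tendsto_timeMean_of_periodic in Theorems/EulerLimitCesaro.lean). At most
300 lines. Cl -/
@[route_item "route-AnomalousDissipation-MirrorVariety", crux]
def SteadyWeakIsGlobalLerayHopf : Prop :=
  ∀ (ν : ℝ) (f : UnitAddTorus (Fin 3) → EuclideanSpace ℝ (Fin 3)) (u : ↥(Literature.Analysis.FunctionSpaces.Torus.energySpace (Fin 3))), 0 < ν → Literature.Analysis.FunctionSpaces.Torus.IsSmooth f → Literature.Analysis.FunctionSpaces.Torus.HasZeroMean f → (u : MeasureTheory.Lp (EuclideanSpace ℝ (Fin 3)) 2 (MeasureTheory.volume : MeasureTheory.Measure (UnitAddTorus (Fin 3)))) ∈ Literature.Analysis.FunctionSpaces.Torus.energySpaceV (Fin 3) → Literature.Analysis.FluidPDE.Torus.IsSteadyWeakSolution ν f u → ν * (Literature.Analysis.FunctionSpaces.Torus.eGradNormSq ((u : MeasureTheory.Lp (EuclideanSpace ℝ (Fin 3)) 2 (MeasureTheory.volume : MeasureTheory.Measure (UnitAddTorus (Fin 3)))) : UnitAddTorus (Fin 3) → EuclideanSpace ℝ (Fin 3))).toReal = Literature.Analysis.FluidPDE.Torus.pairing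 (u : MeasureTheory.Lp (EuclideanSpace ℝ (Fin 3)) 2 (MeasureTheory.volume : MeasureTheory.Measure (UnitAddTorus (Fin 3)))) f → Literature.Analysis.FluidPDE.Torus.IsGlobalLerayHopf ν (fun _ => f) ((u : MeasureTheory.Lp (EuclideanSpace ℝ (Fin 3)) 2 (MeasureTheory.volume : MeasureTheory.Measure (UnitAddTorus (Fin 3)))) : UnitAddTorus (Fin 3) → EuclideanSpace ℝ (Fin 3)) (fun _ => ((u : MeasureTheory.Lp (EuclideanSpace ℝ (Fin 3)) 2 (MeasureTheory.volume : MeasureTheory.Measure (UnitAddTorus (Fin 3)))) : UnitAddTorus (Fin 3) → EuclideanSpace ℝ (Fin 3))) ∧ Literature.Analysis.FluidPDE.meanEnergy (fun _ : ℝ => ((u : MeasureTheory.Lp (EuclideanSpace ℝ (Fin 3)) 2 (MeasureTheory.volume : MeasureTheory.Measure (UnitAddTorus (Fin 3)))) : UnitAddTorus (Fin 3) → EuclideanSpace ℝ (Fin 3))) = ∫ x, ‖(u : MeasureTheory.Lp (EuclideanSpace ℝ (Fin 3)) 2 (MeasureTheory.volume : MeasureTheory.Measure (UnitAddTorus (Fin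 3)))) x‖ ^ 2 ∧ Literature.Analysis.FluidPDE.meanDissipation ν (fun _ : ℝ => ((u : MeasureTheory.Lp (EuclideanSpace ℝ (Fin 3)) 2 (MeasureTheory.volume : MeasureTheory.Measure (UnitAddTorus (Fin 3)))) : UnitAddTorus (Fin 3) → EuclideanSpace ℝ (Fin 3))) = ν * (Literature.Analysis.FunctionSpaces.Torus.eGradNormSq ((u : MeasureTheory.Lp (EuclideanSpace ℝ (Fin 3)) 2 (MeasureTheory.volume : MeasureTheory.Measure (UnitAddTorus (Fin 3)))) : UnitAddTorus (Fin 3) → EuclideanSpace ℝ (Fin 3))).toReal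

/-- item stmt-AnomalousDissipation-2993 · assembly · rank 1 · closed · proved by Summit.AnomalousDissipation.AnomalousDissipation.Theorems.assembly_proof (prover) · by planner
sources: Temam1979, DoeringFoias2002
GalerkinSteadyZerothLaw → AnomalousDissipation (= Literature.Turb.ZerothLaw). Proof map (at most 80
lines given the two supports): from X take f (smooth, div-free, mean-zero), ν_j → 0⁺, E, ε; for each
j apply FixedViscosityTransfer at ν = ν_j to get u_j ∈ V, a steady weak solution with ∫|u_j|² ≤ E
and ν_j‖∇u_j‖² = (f, u_j) ≥ ε; apply SteadyWeakIsGlobalLerayHopf: the constant path is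
IsGlobalLerayHopf (ν j) (fun _ => f) u_j (fun _ => u_j) with meanEnergy = ∫|u_j|² ≤ E and
meanDissipation = ν_j‖∇u_j‖² ≥ ε; these are verbatim the witnesses of Literature.Turb.ZerothLaw (u₀
j := u_j). If the supports have not landed, prove them inline or first (they are the whole content). -/
@[route_item "route-AnomalousDissipation-MirrorVariety"]
def Assembly : Prop :=
  GalerkinSteadyZerothLaw → AnomalousDissipation

/-! D-0027 §2.1 — DECIDING THEOREM (planner-authored via `route open/edit --closes-file`; by planner-rbadge-AnomalousDissipation-MirrorVari-d027a476-0 2026-08-16T03:12:01Z):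
its hypotheses are this route's items and its conclusion the sub-problem Statement (glue_lint), and it elaborates with this file. -/

@[closes "route-AnomalousDissipation-MirrorVariety"] theorem closes (hX : GalerkinSteadyZerothLaw) (hT : FixedViscosityTransfer)
    (hS : SteadyWeakIsGlobalLerayHopf) : _root_.AnomalousDissipation := by
  obtain ⟨f, hf, hdf, hzf, ν, E, ε, hν, hν0, hε, hj⟩ := hX
  choose u huV husol huE huε hueq using fun j => hT (ν j) E ε f (hν j) hf hdf hzf (hj j)
  have hLH := fun j => hS (ν j) f (u j) (hν j) hf hzf (huV j) (husol j) (hueq j)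
  refine ⟨f, hf, hdf, hzf, ν,
    fun j => ((u j : MeasureTheory.Lp (EuclideanSpace ℝ (Fin 3)) 2
      (MeasureTheory.volume : MeasureTheory.Measure (UnitAddTorus (Fin 3)))) :
        UnitAddTorus (Fin 3) → EuclideanSpace ℝ (Fin 3)),
    fun j _ => ((u j : MeasureTheory.Lp (EuclideanSpace ℝ (Fin 3)) 2
      (MeasureTheory.volume : MeasureTheory.Measure (UnitAddTorus (Fin 3)))) :
        UnitAddTorus (Fin 3) → EuclideanSpace ℝ (Fin 3)),
    hν, hν0, fun j => (hLH j).1, ⟨E, fun j => ?_⟩, ⟨ε, hε, fun j => ?_⟩⟩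
  · rw [(hLH j).2.1]; exact huE j
  · rw [(hLH j).2.2, hueq j]; exact huε j

end Summit.AnomalousDissipation.AnomalousDissipation.Theses.MirrorVariety
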